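import Mathlib
import HarnessLib
import Summits.AtomisticToContinuum.BoseEinsteinCondensation.Theses.BECFisherTransfer
import Summits.AtomisticToContinuum.BoseEinsteinCondensation.Theorems.BECFisherTransferGroundStateRepresentationForms

/-!
# Route `BECFisherTransfer` — support `GroundStateRepresentation` (stmt-AtomisticToContinuum-14305)

**The ground-state representation on the torus.** For an arbitrary pair-potential profile
`v : ℝ → ℝ≥0∞`, an exact real strictly positive admissible periodic minimiser `Ψ₀` of the periodic
`N`-body energy on the torus of side `L` (`periodicEnergy v Ψ₀ = E₀^per(N, L)`) and any real
admissible periodic state `Φ`,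

  `periodicEnergy v Φ = E₀^per + ¼ I_{cell^N}(P_Φ‖P_Ψ₀) = E₀^per + ∫_{cell^N} |∇(Φ/Ψ₀)|² Ψ₀²`

(`relativeFisherInformation` carries the factor `4`). This is the route decl
`Summit.AtomisticToContinuum.BoseEinsteinCondensation.Theses.BECFisherTransfer.GroundStateRepresentation`,
proved here as `groundStateRepresentation_proof`.

## Proof

* `E₀^per = ⊤`: both sides are `⊤` (`⊤ + x = ⊤`, `E(Φ) ≥ E₀^per`).
* `E₀^per < ⊤`. The item quantifies over *all* `v`, so `X ↦ ∑_{i<j} v^per(xᵢ - xⱼ)` need not be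
  measurable and the lower Lebesgue integral of the interaction term is only superadditive. This
  is harmless: since `∫⁻ W |Ψ₀|² ≤ E(Ψ₀) < ⊤` with `|Ψ₀|² > 0` continuous, a single application of
  `exists_measurable_le_lintegral_eq` produces a measurable finite minorant `G ≤ W` with
  `∫⁻ W a = ∫⁻ G a` for **every** measurable finite `a` (`exists_measurable_minorant`: a
  measurable `g ≤ W a` gives `max φ ((g/a)|Ψ₀|²) ≤ W|Ψ₀|²` with the same finite integral as the
  maximiser `φ`, hence `g ≤ G a` a.e.); the kinetic term is measurable and splits off
  (`lintegral_add_left`), so the periodic energy of every admissible state is the `G`-weighted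
  energy `Q_G(Ψ) = ∫⁻ (|∇Ψ|² + G|Ψ|²)` (`exists_measurable_weight`), which `Ψ₀` minimises.
* For a measurable finite weight (`weighted_groundStateRepresentation`): write `ψ₀ = Re Ψ₀ > 0`,
  `φ = Re Φ`, `h = φ/ψ₀ ∈ C¹`, `η = h²ψ₀`. All potential terms `G ψ₀² · (bounded continuous)` are
  integrable on the bounded cell, so every energy is the `ofReal` of a real Bochner integral
  (`weightedForm_ofReal_eq`). The variational inequality `Q_G(Ψ₀) ∫|ψ|² ≤ Q_G(ψ)` for the
  unnormalised admissible `ψ = ψ₀ + tη` (`lowerBound_mul_mass_le`, via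
  `PeriodicTrialState.ofFun`) is a one-signed quadratic in `t` vanishing at `t = 0`
  (`∫ ηψ₀ = ∫ φ² = 1`), whence the first variation
  `∫ (∇η·∇ψ₀ + G ηψ₀) = Q_G(Ψ₀)` (`discrim_le_zero`). Jacobi's identity
  `|∇(hψ₀)|² = ψ₀²|∇h|² + ∇(h²ψ₀)·∇ψ₀` (`gradDot_mul_self_eq`) then gives
  `Q_G(Φ) = ∫ ψ₀²|∇h|² + Q_G(Ψ₀) = Q_G(Ψ₀) + ¼ I(P_Φ‖P_Ψ₀)`.

## References

* [LSSY2005] E. H. Lieb, R. Seiringer, J. P. Solovej, J. Yngvason, *The Mathematics of the Bose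
  Gas and its Condensation*, Birkhäuser 2005, (6.26)–(6.28) (substitution `Ψ = F Ψ₀`, "using
  partial integration and the variational equation").
* [AlbeverioHoeghkrohnStreit1977] S. Albeverio, R. Høegh-Krohn, L. Streit, *Energy forms,
  Hamiltonians, and distorted Brownian paths*, J. Math. Phys. 18 (1977) 907–917 (ground-state
  transformation of the Dirichlet form).
* [RezakhanlouVillani2008] F. Rezakhanlou, C. Villani, *Entropy Methods for the Boltzmann
  Equation*, LNM 1916, Part I §1.3.1 (relative Fisher information).
* [Fournais2020] S. Fournais, *Length scales for BEC in the dilute Bose gas*, (1.1)–(1.2) (the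
  periodic problem).
-/

noncomputable section

open MeasureTheory Filter Set
open scoped ENNReal NNReal Topology BigOperators

namespace Summit.AtomisticToContinuum.BoseEinsteinCondensation.Theorems

open Literature.MathematicalPhysics.QuantumManyBody.BoseGas

namespace FisherGroundStateRepresentation

variable {N : ℕ} {L : ℝ} {W : Config N → ℝ≥0∞}

/-! ### The ground-state representation for a measurable finite weight -/

/-- **Ground-state representation, weighted form.** Let `W ≥ 0` be a measurable, finite weight on
`(ℝ³)^N` and `Q_W(ψ) = ∫⁻_{cell} (|∇ψ|² + W|ψ|²)`. If the real, strictly positive admissible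
periodic state `Ψ₀` minimises `Q_W` over admissible periodic states, with `Q_W(Ψ₀) < ∞`, then
for every real admissible periodic state `Φ`
`Q_W(Φ) = Q_W(Ψ₀) + ¼ I_{cell}(P_Φ‖P_Ψ₀) = Q_W(Ψ₀) + ∫_{cell} |∇(Φ/Ψ₀)|² Ψ₀²`.
Proof: first variation of the Rayleigh quotient at `Ψ₀` in the admissible direction
`η = h²Ψ₀ = Φ²/Ψ₀` (`h = Φ/Ψ₀`), i.e. `∫ ∇η·∇Ψ₀ + WηΨ₀ = Q_W(Ψ₀) ∫ ηΨ₀ = Q_W(Ψ₀)`, inserted in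
Jacobi's identity `|∇(hΨ₀)|² = Ψ₀²|∇h|² + ∇(h²Ψ₀)·∇Ψ₀`; all potential terms are integrable
because `∫ WΨ₀² ≤ Q_W(Ψ₀) < ∞` and `h` is bounded on the cell.
[cite: LSSY2005, (6.26)–(6.28); AlbeverioHoeghkrohnStreit1977] -/
theorem weighted_groundStateRepresentation (hWm : Measurable W) (hWtop : ∀ X, W X ≠ ⊤)
    (Ψ₀ Φ : PeriodicTrialState N L)
    (hmin : ∀ Ψ : PeriodicTrialState N L,
      ∫⁻ X in cellN N L, (kineticDensity Ψ₀.ψ X + W X * (‖Ψ₀.ψ X‖₊ : ℝ≥0∞) ^ 2) ≤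
        ∫⁻ X in cellN N L, (kineticDensity Ψ.ψ X + W X * (‖Ψ.ψ X‖₊ : ℝ≥0∞) ^ 2))
    (hfin : ∫⁻ X in cellN N L, (kineticDensity Ψ₀.ψ X + W X * (‖Ψ₀.ψ X‖₊ : ℝ≥0∞) ^ 2) ≠ ⊤)
    (hΨ₀ : ∀ X, Ψ₀.ψ X = ((Ψ₀.ψ X).re : ℂ) ∧ 0 < (Ψ₀.ψ X).re)
    (hΦ : ∀ X, Φ.ψ X = ((Φ.ψ X).re : ℂ)) :
    ∫⁻ X in cellN N L, (kineticDensity Φ.ψ X + W X * (‖Φ.ψ X‖₊ : ℝ≥0∞) ^ 2) =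
      (∫⁻ X in cellN N L, (kineticDensity Ψ₀.ψ X + W X * (‖Ψ₀.ψ X‖₊ : ℝ≥0∞) ^ 2)) +
        4⁻¹ * relativeFisherInformation (cellN N L) (fun X => (Φ.ψ X).re)
          (fun X => (Ψ₀.ψ X).re) := by
  set E₀ : ℝ≥0∞ := ∫⁻ X in cellN N L, (kineticDensity Ψ₀.ψ X + W X * (‖Ψ₀.ψ X‖₊ : ℝ≥0∞) ^ 2)
    with hE₀
  set ψ₀ : Config N → ℝ := fun X => (Ψ₀.ψ X).re with hψ₀def
  set φ : Config N → ℝ := fun X => (Φ.ψ X).re with hφdef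
  set h : Config N → ℝ := fun X => φ X / ψ₀ X with hhdef
  set η : Config N → ℝ := fun X => h X * (h X * ψ₀ X) with hηdef
  -- the amplitudes are complexified real functions
  have hΨ₀fun : Ψ₀.ψ = fun X => ((ψ₀ X : ℝ) : ℂ) := funext fun X => (hΨ₀ X).1
  have hΦfun : Φ.ψ = fun X => ((φ X : ℝ) : ℂ) := funext fun X => hΦ X
  have hψ₀pos : ∀ X, 0 < ψ₀ X := fun X => (hΨ₀ X).2
  have hψ₀ne : ∀ X, ψ₀ X ≠ 0 := fun X => (hψ₀pos X).ne'
  have hφh : ∀ X, φ X = h X * ψ₀ X := fun X => (div_mul_cancel₀ (φ X) (hψ₀ne X)).symm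
  have hφfun : φ = fun X => h X * ψ₀ X := funext hφh
  -- regularity
  have hψ₀C : ContDiff ℝ 1 ψ₀ := Complex.reCLM.contDiff.comp Ψ₀.contDiff
  have hφC : ContDiff ℝ 1 φ := Complex.reCLM.contDiff.comp Φ.contDiff
  have hhC : ContDiff ℝ 1 h := hφC.div hψ₀C hψ₀ne
  have hηC : ContDiff ℝ 1 η := hhC.mul (hhC.mul hψ₀C)
  have hψ₀d : ∀ X, DifferentiableAt ℝ ψ₀ X := fun X => (hψ₀C.differentiable one_ne_zero) X
  have hhd : ∀ X, DifferentiableAt ℝ h X := fun X => (hhC.differentiable one_ne_zero) X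
  have hηd : ∀ X, DifferentiableAt ℝ η X := fun X => (hηC.differentiable one_ne_zero) X
  -- periodicity and Bose symmetry
  have hψ₀per : ∀ (X : Config N) (i : Fin N) (a : Fin 3),
      ψ₀ (X + Pi.single i (EuclideanSpace.single a L)) = ψ₀ X := fun X i a => by
    simp only [hψ₀def, Ψ₀.periodic]
  have hψ₀symm : ∀ (σ : Equiv.Perm (Fin N)) (X : Config N), ψ₀ (X ∘ σ) = ψ₀ X := fun σ X => by
    simp only [hψ₀def, Ψ₀.symm]
  have hφper : ∀ (X : Config N) (i : Fin N) (a : Fin 3),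
      φ (X + Pi.single i (EuclideanSpace.single a L)) = φ X := fun X i a => by
    simp only [hφdef, Φ.periodic]
  have hφsymm : ∀ (σ : Equiv.Perm (Fin N)) (X : Config N), φ (X ∘ σ) = φ X := fun σ X => by
    simp only [hφdef, Φ.symm]
  have hηper : ∀ (X : Config N) (i : Fin N) (a : Fin 3),
      η (X + Pi.single i (EuclideanSpace.single a L)) = η X := fun X i a => by
    simp only [hηdef, hhdef, hφper, hψ₀per]
  have hηsymm : ∀ (σ : Equiv.Perm (Fin N)) (X : Config N), η (X ∘ σ) = η X := fun σ X => by
    simp only [hηdef, hhdef, hφsymm, hψ₀symm]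
  -- finiteness of the weighted mass of `ψ₀`, integrability of the potential terms
  have hnormψ₀ : ∀ X, ((‖Ψ₀.ψ X‖₊ : ℝ≥0∞)) ^ 2 = ENNReal.ofReal (ψ₀ X ^ 2) := fun X => by
    rw [(hΨ₀ X).1]
    exact coe_nnnorm_ofReal_sq _
  have hP0fin : ∫⁻ X in cellN N L, W X * ENNReal.ofReal (ψ₀ X ^ 2) ≠ ⊤ := by
    refine ne_top_of_le_ne_top hfin (lintegral_mono fun X => ?_)
    rw [hnormψ₀]
    exact le_add_self
  have hIw : ∀ g : Config N → ℝ, Continuous g →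
      IntegrableOn (fun X => (W X).toReal * ψ₀ X ^ 2 * g X) (cellN N L) := fun g hg =>
    integrableOn_weight_mul hWm hψ₀C.continuous hP0fin hg
  have hIψ₀ : IntegrableOn (fun X => (W X).toReal * ψ₀ X ^ 2) (cellN N L) := by
    simpa only [mul_one] using hIw (fun _ => 1) continuous_const
  have hIφ : IntegrableOn (fun X => (W X).toReal * φ X ^ 2) (cellN N L) := by
    refine (hIw (fun X => h X ^ 2) (hhC.continuous.pow 2)).congr_fun (fun X _ => ?_)
      (measurableSet_cellN N L)
    simp only [hφh]
    ring
  have hIt : ∀ t : ℝ, IntegrableOn (fun X => (W X).toReal * (ψ₀ X + t * η X) ^ 2) (cellN N L) := by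
    intro t
    refine (hIw (fun X => (1 + t * (h X * h X)) ^ 2) (by fun_prop)).congr_fun (fun X _ => ?_)
      (measurableSet_cellN N L)
    simp only [hηdef]
    ring
  have hIB : IntegrableOn (fun X => (W X).toReal * ψ₀ X ^ 2 * (h X * h X)) (cellN N L) :=
    hIw _ (by fun_prop)
  have hIC : IntegrableOn (fun X => (W X).toReal * ψ₀ X ^ 2 * (h X * h X * (h X * h X))) (cellN N L) :=
    hIw _ (by fun_prop)
  have iA : IntegrableOn (fun X => gradDot ψ₀ ψ₀ X + (W X).toReal * ψ₀ X ^ 2) (cellN N L) :=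
    (integrableOn_cellN (continuous_gradDot hψ₀C hψ₀C) L).add hIψ₀
  have iB : IntegrableOn (fun X => gradDot η ψ₀ X + (W X).toReal * ψ₀ X ^ 2 * (h X * h X))
      (cellN N L) := (integrableOn_cellN (continuous_gradDot hηC hψ₀C) L).add hIB
  have iC : IntegrableOn (fun X => gradDot η η X + (W X).toReal * ψ₀ X ^ 2 * (h X * h X * (h X * h X)))
      (cellN N L) := (integrableOn_cellN (continuous_gradDot hηC hηC) L).add hIC
  -- the energy and the masses in real form
  have hE₀real : E₀ = ENNReal.ofReal (∫ X in cellN N L, (gradDot ψ₀ ψ₀ X + (W X).toReal * ψ₀ X ^ 2)) := by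
    rw [hE₀, hΨ₀fun]
    exact weightedForm_ofReal_eq hWtop hψ₀C hIψ₀
  have hE₀toReal : E₀.toReal = ∫ X in cellN N L, (gradDot ψ₀ ψ₀ X + (W X).toReal * ψ₀ X ^ 2) := by
    rw [hE₀real, ENNReal.toReal_ofReal (integral_nonneg fun X => add_nonneg (gradDot_self_nonneg _ X)
      (mul_nonneg ENNReal.toReal_nonneg (sq_nonneg _)))]
  have hM0 : ∫ X in cellN N L, ψ₀ X ^ 2 = 1 := by
    have h1 := Ψ₀.norm_eq
    rw [hΨ₀fun, mass_ofReal_eq hψ₀C.continuous, ENNReal.ofReal_eq_one] at h1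
    exact h1
  have hM1 : ∫ X in cellN N L, η X * ψ₀ X = 1 := by
    have h1 := Φ.norm_eq
    rw [hΦfun, mass_ofReal_eq hφC.continuous, ENNReal.ofReal_eq_one] at h1
    rw [← h1]
    refine integral_congr_ae (ae_of_all _ fun X => ?_)
    simp only [hηdef, hφh]
    ring
  -- the variational inequality along `ψ₀ + t η`, expanded to second order in `t`
  have hvar : ∀ t : ℝ, E₀.toReal * ((∫ X in cellN N L, ψ₀ X ^ 2) +
      2 * t * (∫ X in cellN N L, η X * ψ₀ X) + t ^ 2 * ∫ X in cellN N L, η X ^ 2) ≤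
      (∫ X in cellN N L, (gradDot ψ₀ ψ₀ X + (W X).toReal * ψ₀ X ^ 2)) +
        2 * t * (∫ X in cellN N L, (gradDot η ψ₀ X + (W X).toReal * ψ₀ X ^ 2 * (h X * h X))) +
        t ^ 2 * ∫ X in cellN N L, (gradDot η η X + (W X).toReal * ψ₀ X ^ 2 * (h X * h X * (h X * h X))) := by
    intro t
    have hft : ContDiff ℝ 1 fun X => ψ₀ X + t * η X := hψ₀C.add (contDiff_const.mul hηC)
    have hv := toReal_lowerBound_mul_le hfin hWtop hmin hft
      (fun X i a => by simp only [hψ₀per, hηper]) (fun σ X => by simp only [hψ₀symm, hηsymm]) (hIt t)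
    have hmass : ∫ X in cellN N L, (ψ₀ X + t * η X) ^ 2 = (∫ X in cellN N L, ψ₀ X ^ 2) +
        2 * t * (∫ X in cellN N L, η X * ψ₀ X) + t ^ 2 * ∫ X in cellN N L, η X ^ 2 := by
      rw [← integral_quadratic_expand (integrableOn_cellN (f := fun X => ψ₀ X ^ 2)
        (hψ₀C.continuous.pow 2) L) (integrableOn_cellN (f := fun X => η X * ψ₀ X)
        (hηC.continuous.mul hψ₀C.continuous) L)
        (integrableOn_cellN (f := fun X => η X ^ 2) (hηC.continuous.pow 2) L)]
      refine integral_congr_ae (ae_of_all _ fun X => ?_)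
      ring
    have hform : ∫ X in cellN N L, (gradDot (fun X => ψ₀ X + t * η X) (fun X => ψ₀ X + t * η X) X +
        (W X).toReal * (ψ₀ X + t * η X) ^ 2) =
        (∫ X in cellN N L, (gradDot ψ₀ ψ₀ X + (W X).toReal * ψ₀ X ^ 2)) +
        2 * t * (∫ X in cellN N L, (gradDot η ψ₀ X + (W X).toReal * ψ₀ X ^ 2 * (h X * h X))) +
        t ^ 2 * ∫ X in cellN N L,
          (gradDot η η X + (W X).toReal * ψ₀ X ^ 2 * (h X * h X * (h X * h X))) := by
      rw [← integral_quadratic_expand iA iB iC]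
      refine integral_congr_ae (ae_of_all _ fun X => ?_)
      dsimp only
      rw [gradDot_add_mul_self (hψ₀d X) (hηd X)]
      simp only [hηdef]
      ring
    rw [hmass, hform] at hv
    exact hv
  -- first variation: the linear coefficient vanishes
  have hfirst : ∫ X in cellN N L, (gradDot η ψ₀ X + (W X).toReal * ψ₀ X ^ 2 * (h X * h X)) =
      E₀.toReal := by
    rw [hM0, hM1, ← hE₀toReal] at hvar
    -- `0 ≤ a t² + 2 b t` for all `t` forces `b = 0` (non-positive discriminant)
    have hd := discrim_le_zero (K := ℝ)
      (a := (∫ X in cellN N L, (gradDot η η X + (W X).toReal * ψ₀ X ^ 2 * (h X * h X * (h X * h X)))) -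
        E₀.toReal * ∫ X in cellN N L, η X ^ 2)
      (b := 2 * ((∫ X in cellN N L, (gradDot η ψ₀ X + (W X).toReal * ψ₀ X ^ 2 * (h X * h X))) -
        E₀.toReal)) (c := 0) fun t => by
        have hv := hvar t
        nlinarith [hv]
    rw [discrim] at hd
    nlinarith [hd, sq_nonneg ((∫ X in cellN N L, (gradDot η ψ₀ X + (W X).toReal * ψ₀ X ^ 2 *
      (h X * h X))) - E₀.toReal)]
  -- Jacobi's identity, integrated: `∫ (|∇φ|² + Wφ²) = ∫ ψ₀²|∇h|² + E₀`
  have hID : IntegrableOn (fun X => gradDot h h X * ψ₀ X ^ 2) (cellN N L) :=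
    integrableOn_cellN ((continuous_gradDot hhC hhC).mul (hψ₀C.continuous.pow 2)) L
  have hJacobi : ∫ X in cellN N L, (gradDot φ φ X + (W X).toReal * φ X ^ 2) =
      (∫ X in cellN N L, gradDot h h X * ψ₀ X ^ 2) + E₀.toReal := by
    rw [← hfirst, ← integral_add hID iB]
    refine integral_congr_ae (ae_of_all _ fun X => ?_)
    dsimp only
    rw [hφfun, gradDot_mul_self_eq (hhd X) (hψ₀d X)]
    ring
  -- the relative Fisher information in real form
  have hFisher : 4⁻¹ * relativeFisherInformation (cellN N L) φ ψ₀ =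
      ENNReal.ofReal (∫ X in cellN N L, gradDot h h X * ψ₀ X ^ 2) := by
    rw [ofReal_integral_eq_lintegral_ofReal hID (ae_of_all _ fun X =>
      mul_nonneg (gradDot_self_nonneg _ X) (sq_nonneg _)), relativeFisherInformation]
    simp only [relFisherDensity_eq_ofReal]
    rw [show (fun X => ENNReal.ofReal (4 * (gradDot (fun Y => φ Y / ψ₀ Y) (fun Y => φ Y / ψ₀ Y) X *
        ψ₀ X ^ 2))) = fun X => 4 * ENNReal.ofReal (gradDot h h X * ψ₀ X ^ 2) from funext fun X => by
        rw [ENNReal.ofReal_mul zero_le_four, ENNReal.ofReal_ofNat],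
      lintegral_const_mul' _ _ ENNReal.ofNat_ne_top, ← mul_assoc,
      ENNReal.inv_mul_cancel (by norm_num) ENNReal.ofNat_ne_top, one_mul]
  -- conclusion
  rw [hFisher, hΦfun, weightedForm_ofReal_eq hWtop hφC hIφ, hJacobi,
    ENNReal.ofReal_add (integral_nonneg fun X => mul_nonneg (gradDot_self_nonneg _ X) (sq_nonneg _))
      ENNReal.toReal_nonneg, ENNReal.ofReal_toReal hfin, add_comm]


end FisherGroundStateRepresentation

/-! ### The route item -/

open FisherGroundStateRepresentation in
/-- **Ground-state representation on the torus** (item `GroundStateRepresentation` of route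
`BECFisherTransfer`, stmt-AtomisticToContinuum-14305). For *any* pair-potential profile
`v : ℝ → ℝ≥0∞`, any `N, L`, an exact real strictly positive admissible periodic minimiser `Ψ₀`
(`periodicEnergy v Ψ₀ = E₀^per(N, L)`) and any real admissible periodic state `Φ`,
`periodicEnergy v Φ = E₀^per + ¼ I_{cell^N}(P_Φ‖P_Ψ₀) = E₀^per + ∫_{cell^N} |∇(Φ/Ψ₀)|² Ψ₀²`.
If `E₀^per = ⊤` both sides are `⊤`. Otherwise the (possibly non-measurable) interaction is
replaced by its measurable minorant against which all energies are honest integrals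
(`exists_measurable_weight`), and the identity is the first variation of the Rayleigh quotient
at `Ψ₀` in the direction `Φ²/Ψ₀` combined with Jacobi's identity
(`weighted_groundStateRepresentation`). [cite: LSSY2005, (6.26)–(6.28);
AlbeverioHoeghkrohnStreit1977; RezakhanlouVillani2008, Part I §1.3.1] -/
theorem groundStateRepresentation_proof :
    Summit.AtomisticToContinuum.BoseEinsteinCondensation.Theses.BECFisherTransfer.GroundStateRepresentation := by
  intro v N L Ψ₀ Φ hmin hΨ₀ hΦ
  -- the trivial branch `E₀ = ⊤`
  rcases eq_or_ne (periodicGroundStateEnergy v N L) ⊤ with htop | htop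
  · rw [htop, top_add]
    exact eq_top_iff.mpr (htop.ge.trans (periodicGroundStateEnergy_le v Φ))
  -- replace the interaction by its measurable minorant
  have h0 : ∀ X, Ψ₀.ψ X ≠ 0 := fun X hX => by
    have h := (hΨ₀ X).2
    rw [hX, Complex.zero_re] at h
    exact lt_irrefl 0 h
  have hfinV : ∫⁻ X in cellN N L, periodicInteraction v L X * (‖Ψ₀.ψ X‖₊ : ℝ≥0∞) ^ 2 ≠ ⊤ := by
    refine ne_top_of_le_ne_top (hmin ▸ htop : periodicEnergy v Ψ₀ ≠ ⊤) (lintegral_mono fun X => ?_)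
    exact le_add_self
  obtain ⟨G, hGm, -, hGtop, hEG⟩ := exists_measurable_weight v Ψ₀ h0 hfinV
  have hminG : ∀ Ψ : PeriodicTrialState N L,
      ∫⁻ X in cellN N L, (kineticDensity Ψ₀.ψ X + G X * (‖Ψ₀.ψ X‖₊ : ℝ≥0∞) ^ 2) ≤
        ∫⁻ X in cellN N L, (kineticDensity Ψ.ψ X + G X * (‖Ψ.ψ X‖₊ : ℝ≥0∞) ^ 2) := fun Ψ => by
    rw [← hEG, ← hEG, hmin]
    exact periodicGroundStateEnergy_le v Ψ
  have hfinG : ∫⁻ X in cellN N L, (kineticDensity Ψ₀.ψ X + G X * (‖Ψ₀.ψ X‖₊ : ℝ≥0∞) ^ 2) ≠ ⊤ := by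
    rw [← hEG, hmin]
    exact htop
  rw [hEG Φ, weighted_groundStateRepresentation hGm hGtop Ψ₀ Φ hminG hfinG hΨ₀ hΦ, ← hEG Ψ₀, hmin]

end Summit.AtomisticToContinuum.BoseEinsteinCondensation.Theorems

end
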